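import Mathlib
import Literature.Analysis.FluidPDE.SuitableWeak
import Literature.Analysis.FluidPDE.LeraySeparationOfEnergyTools
import Summits.NavierStokesRegularity.NavierStokesRegularity.Theses.EulerZoomLiouville
import Summits.NavierStokesRegularity.NavierStokesRegularity.Theorems.EulerZoomLiouvillePowerGaugeEulerLiouvilleSteadyTools
import HarnessLib

/-!
# BC5 rung B of the crux `EulerZoomLiouville.PowerGaugeEulerLiouville`: steady members vanish

§B candidate of record `EulerZoomLiouville` (NavierStokesRegularity, residual `NoTypeII` =
stmt-NavierStokesRegularity-0056), attacked conjunct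
`E = PowerGaugeEulerLiouville`: an ancient local-energy Euler flow on `ℝ³ × (−∞, 0)` whose
power-gauged CKN quantities at the origin satisfy Seregin's bound
`sup_{a > 0} (a^{2ρ} A(a) + a^{ρ} E(a) + a^{2ρ} D(a)) ≤ c` vanishes.  This file proves the rung
INSIDE the open window `0 < ρ ≤ 1/2` on the STEADY stratum (the planners' plan-only
`bc/PowerGaugeEulerLiouville_rungB_plan.lean`, typed verbatim as `powerGaugeEulerLiouville_steady`):
a time-independent member `u(t, x) = U(x)` of the class is zero, for every `ρ > 0` (indeed the
argument only uses `ρ > −1`).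

Proof.  (1) The `E`-gauge gives `∫∫_{Q_a} |H|²_F ≤ c a^{1−ρ}` for the space–time weak gradient
`H`; averaging the defining identity of `H` against a normalised time bump of height `≤ 2/a²`
supported in `(−a², 0)` shows that every spatial pairing `∫ ∂_v ψ ⟪U, w⟫` is bounded by
`O(a^{−(1+ρ)/2}) → 0`, so `U` has the ZERO weak derivative on `ℝ³`
(`integral_fderiv_mul_inner_eq_zero_of_steady`, `hasWeakFDerivOn_zero_of_steady`).
(2) A function with zero weak derivative on the whole space is a.e. constant — mollifications
have zero derivative, hence are constant, and converge a.e. (`ae_eq_const_of_hasWeakFDerivOn_zero`,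
via the tree's `Literature.Analysis.FunctionSpaces.HasWeakFDerivOn.hasFDerivAt_convolution`).
(3) The `A`-gauge `a^{2ρ} · a⁻¹ · ‖b‖² |B_a| ≤ c` kills the constant (`const_eq_zero_of_gaugeA`).
The Euler system and the local energy inequality are NOT used: on the steady stratum the gauges
decide by themselves (critic-2's K-READ 01: rung B is "large-scale arithmetic").
WHAT THIS IS NOT: not NS regularity, not `NoTypeII`; a kernel-checked rung of the §B conjunct `E`.
-/

noncomputable section

set_option linter.dupNamespace false

open MeasureTheory Set Filter Topology Metric Function TopologicalSpace
open scoped ENNReal NNReal Convolution InnerProductSpace RealInnerProductSpace ContDiff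

namespace Summit.NavierStokesRegularity.NavierStokesRegularity.Theorems.PowerGaugeEulerLiouville

open Literature.Analysis Literature.Analysis.FunctionSpaces Literature.Analysis.FluidPDE

section Steady

/-- **The `E`-gauge supplies the averaging hypothesis.**  If `a^{ρ} E(a; 0) ≤ c` for all `a > 0`
(`E(a) = a⁻¹ ∫∫_{Q_a} |H|²_F`, tree `cknE`) with `ρ > −1`, then `∫∫_{Q_a} |H|²_F ≤ c a^{1−ρ}`, and by
Cauchy–Schwarz on `(−a², 0) × B_R ⊆ Q_a` the `L¹` mass of `H` there is
`≤ (c |B_R|)^{1/2} a^{(3−ρ)/2} = o(a²)`. [folklore] -/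
theorem small_of_gaugeE {ρ : ℝ} (hρ : -1 < ρ)
    {H : ℝ → EuclideanSpace ℝ (Fin 3) → EuclideanSpace ℝ (Fin 3) →L[ℝ] EuclideanSpace ℝ (Fin 3)}
    (hHmeas : AEStronglyMeasurable (uncurry H)
      (volume.restrict (Iio (0 : ℝ) ×ˢ (univ : Set (EuclideanSpace ℝ (Fin 3))))))
    {c : ℝ≥0}
    (hE : ∀ a : ℝ, 0 < a →
      ENNReal.ofReal (a ^ ρ) * cknE a (0 : ℝ × EuclideanSpace ℝ (Fin 3)) H ≤ (c : ℝ≥0∞)) :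
    ∀ R : ℝ, 0 < R → ∀ ε : ℝ, 0 < ε → ∃ a : ℝ, R < a ∧
      ∫⁻ q in Ioo (-(a ^ 2)) 0 ×ˢ ball (0 : EuclideanSpace ℝ (Fin 3)) R, ‖H q.1 q.2‖ₑ ≤
        ENNReal.ofReal ε * ENNReal.ofReal (a ^ 2) := by
  intro R hR ε hε
  have hVtop : volume (ball (0 : EuclideanSpace ℝ (Fin 3)) R) ≠ ⊤ := measure_ball_lt_top.ne
  set V : ℝ := (volume (ball (0 : EuclideanSpace ℝ (Fin 3)) R)).toReal with hV
  have hV0 : 0 ≤ V := ENNReal.toReal_nonneg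
  set L : ℝ := Real.sqrt (V * c) with hL
  have hL0 : 0 ≤ L := Real.sqrt_nonneg _
  -- choose `a` large: `a > max R 1` and `L / ε ≤ a^{(1+ρ)/2}`
  have hev : ∀ᶠ a : ℝ in atTop, L / ε ≤ a ^ ((1 + ρ) / 2) :=
    (tendsto_rpow_atTop (by linarith : 0 < (1 + ρ) / 2)).eventually_ge_atTop _
  obtain ⟨a, ha1, ha2⟩ := (hev.and (eventually_gt_atTop (max R 1))).exists
  have hRa : R < a := (le_max_left _ _).trans_lt ha2
  have ha0 : 0 < a := hR.trans hRa
  refine ⟨a, hRa, ?_⟩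
  set S : Set (ℝ × EuclideanSpace ℝ (Fin 3)) :=
    Ioo (-(a ^ 2)) 0 ×ˢ ball (0 : EuclideanSpace ℝ (Fin 3)) R with hS
  have hSsubQ : S ⊆ parabolicCylinder a (0 : ℝ × EuclideanSpace ℝ (Fin 3)) := by
    rintro ⟨t, x⟩ ⟨ht, hx⟩
    refine mem_prod.2 ⟨?_, ball_subset_ball hRa.le hx⟩
    simpa using ht
  have hSsub : S ⊆ Iio (0 : ℝ) ×ˢ (univ : Set (EuclideanSpace ℝ (Fin 3))) :=
    prod_mono (fun t ht => ht.2) (subset_univ _)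
  have hmeasS : AEMeasurable (fun q : ℝ × EuclideanSpace ℝ (Fin 3) => ‖H q.1 q.2‖ₑ)
      (volume.restrict S) :=
    (hHmeas.mono_measure (Measure.restrict_mono hSsub le_rfl)).enorm
  -- the dissipation bound on `Q_a` from the gauge
  have hQ : ∫⁻ q in parabolicCylinder a (0 : ℝ × EuclideanSpace ℝ (Fin 3)),
      ENNReal.ofReal (frobeniusNormSq (H q.1 q.2)) ≤ ENNReal.ofReal (a ^ (1 - ρ) * c) := by
    have h1 := hE a ha0
    unfold cknE at h1
    set X := ∫⁻ q in parabolicCylinder a (0 : ℝ × EuclideanSpace ℝ (Fin 3)),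
      ENNReal.ofReal (frobeniusNormSq (H q.1 q.2)) with hX
    have hB0 : ENNReal.ofReal (a ^ ρ) ≠ 0 := by
      rw [ENNReal.ofReal_ne_zero_iff]; exact Real.rpow_pos_of_pos ha0 _
    have hA0 : ENNReal.ofReal a ≠ 0 := by rw [ENNReal.ofReal_ne_zero_iff]; exact ha0
    have key : X = ENNReal.ofReal a * (ENNReal.ofReal (a ^ ρ))⁻¹ *
        (ENNReal.ofReal (a ^ ρ) * ((ENNReal.ofReal a)⁻¹ * X)) := by
      rw [← mul_assoc, mul_assoc (ENNReal.ofReal a), ENNReal.inv_mul_cancel hB0 ENNReal.ofReal_ne_top,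
        mul_one, ← mul_assoc, ENNReal.mul_inv_cancel hA0 ENNReal.ofReal_ne_top, one_mul]
    calc X = _ := key
      _ ≤ ENNReal.ofReal a * (ENNReal.ofReal (a ^ ρ))⁻¹ * (c : ℝ≥0∞) := by gcongr
      _ = ENNReal.ofReal (a ^ (1 - ρ) * c) := by
          rw [← ENNReal.ofReal_inv_of_pos (Real.rpow_pos_of_pos ha0 _), ← ENNReal.ofReal_mul ha0.le,
            ← ENNReal.ofReal_coe_nnreal, ← ENNReal.ofReal_mul (by positivity)]
          congr 1
          rw [Real.rpow_sub ha0, Real.rpow_one, div_eq_mul_inv]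
  -- Cauchy–Schwarz on `S`
  have hCS : ∫⁻ q in S, ‖H q.1 q.2‖ₑ ≤
      (volume S) ^ (1 / 2 : ℝ) * (∫⁻ q in S, ‖H q.1 q.2‖ₑ ^ (2 : ℝ)) ^ (1 / 2 : ℝ) := by
    have h := ENNReal.lintegral_mul_le_Lp_mul_Lq (volume.restrict S) Real.HolderConjugate.two_two
      (f := fun _ => 1) aemeasurable_const hmeasS
    simpa only [Pi.mul_apply, one_mul, ENNReal.one_rpow, lintegral_const, Measure.restrict_apply_univ]
      using h
  have hvolS : volume S = ENNReal.ofReal (a ^ 2 * V) := by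
    rw [hS, Measure.volume_eq_prod, Measure.prod_prod, Real.volume_Ioo, ENNReal.ofReal_mul (by positivity),
      ENNReal.ofReal_toReal hVtop]
    congr 2
    ring
  have hS2 : ∫⁻ q in S, ‖H q.1 q.2‖ₑ ^ (2 : ℝ) ≤ ENNReal.ofReal (a ^ (1 - ρ) * c) := by
    calc ∫⁻ q in S, ‖H q.1 q.2‖ₑ ^ (2 : ℝ)
        ≤ ∫⁻ q in S, ENNReal.ofReal (frobeniusNormSq (H q.1 q.2)) := by
          refine lintegral_mono fun q => ?_
          rw [ENNReal.rpow_two]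
          exact enorm_opNorm_sq_le_ofReal_frobeniusNormSq _
      _ ≤ ∫⁻ q in parabolicCylinder a (0 : ℝ × EuclideanSpace ℝ (Fin 3)),
            ENNReal.ofReal (frobeniusNormSq (H q.1 q.2)) := lintegral_mono_set hSsubQ
      _ ≤ _ := hQ
  -- the real inequality `√(a² V) √(a^{1−ρ} c) ≤ ε a²`
  have hreal : (a ^ 2 * V) ^ (1 / 2 : ℝ) * (a ^ (1 - ρ) * c) ^ (1 / 2 : ℝ) ≤ ε * a ^ 2 := by
    have hprod : (a ^ 2 * V) ^ (1 / 2 : ℝ) * (a ^ (1 - ρ) * c) ^ (1 / 2 : ℝ) =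
        L * a ^ ((3 - ρ) / 2) := by
      rw [← Real.mul_rpow (by positivity) (by positivity)]
      have h3 : a ^ 2 * V * (a ^ (1 - ρ) * c) = (V * c) * a ^ (3 - ρ) := by
        have h4 : a ^ (3 - ρ) = a ^ 2 * a ^ (1 - ρ) := by
          rw [show (3 - ρ : ℝ) = ((2 : ℕ) : ℝ) + (1 - ρ) by push_cast; ring, Real.rpow_add ha0,
            Real.rpow_natCast]
        rw [h4]; ring
      rw [h3, Real.mul_rpow (by positivity) (Real.rpow_nonneg ha0.le _), hL, Real.sqrt_eq_rpow,
        ← Real.rpow_mul ha0.le]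
      congr 2
      ring
    have hsplit : a ^ 2 = a ^ ((1 + ρ) / 2) * a ^ ((3 - ρ) / 2) := by
      rw [← Real.rpow_add ha0, show ((1 + ρ) / 2 + (3 - ρ) / 2 : ℝ) = ((2 : ℕ) : ℝ) by ring,
        Real.rpow_natCast]
    have hLe : L ≤ ε * a ^ ((1 + ρ) / 2) := by
      rw [div_le_iff₀ hε] at ha1
      linarith [ha1]
    rw [hprod, hsplit]
    calc L * a ^ ((3 - ρ) / 2) ≤ (ε * a ^ ((1 + ρ) / 2)) * a ^ ((3 - ρ) / 2) :=
          mul_le_mul_of_nonneg_right hLe (Real.rpow_nonneg ha0.le _)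
      _ = ε * (a ^ ((1 + ρ) / 2) * a ^ ((3 - ρ) / 2)) := by ring
  calc ∫⁻ q in S, ‖H q.1 q.2‖ₑ
      ≤ (volume S) ^ (1 / 2 : ℝ) * (∫⁻ q in S, ‖H q.1 q.2‖ₑ ^ (2 : ℝ)) ^ (1 / 2 : ℝ) := hCS
    _ ≤ (ENNReal.ofReal (a ^ 2 * V)) ^ (1 / 2 : ℝ) *
          (ENNReal.ofReal (a ^ (1 - ρ) * c)) ^ (1 / 2 : ℝ) := by
        rw [hvolS]
        gcongr
    _ = ENNReal.ofReal ((a ^ 2 * V) ^ (1 / 2 : ℝ) * (a ^ (1 - ρ) * c) ^ (1 / 2 : ℝ)) := by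
        rw [ENNReal.ofReal_rpow_of_nonneg (by positivity) (by norm_num),
          ENNReal.ofReal_rpow_of_nonneg (by positivity) (by norm_num),
          ENNReal.ofReal_mul (by positivity)]
    _ ≤ ENNReal.ofReal (ε * a ^ 2) := ENNReal.ofReal_le_ofReal hreal
    _ = ENNReal.ofReal ε * ENNReal.ofReal (a ^ 2) := ENNReal.ofReal_mul hε.le

/-! ## (3) The `A`-gauge kills constants -/

/-- **A constant with bounded `a^{2ρ} A(a)` vanishes** (`ρ > −1`): for `U = b` a.e.,
`A(a; 0) ≥ a⁻¹ ‖b‖² |B_a| = ‖b‖² |B₁| a²`, so `‖b‖² |B₁| a^{2ρ+2} ≤ c` for all `a > 0`, which forces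
`b = 0` as `a → ∞`. [folklore] -/
theorem const_eq_zero_of_gaugeA {ρ : ℝ} (hρ : -1 < ρ)
    {U : EuclideanSpace ℝ (Fin 3) → EuclideanSpace ℝ (Fin 3)} {b : EuclideanSpace ℝ (Fin 3)}
    (hb : U =ᵐ[volume] fun _ => b) {c : ℝ≥0}
    (hA : ∀ a : ℝ, 0 < a → ENNReal.ofReal (a ^ (2 * ρ)) *
      cknA a (0 : ℝ × EuclideanSpace ℝ (Fin 3)) (fun _ : ℝ => U) ≤ (c : ℝ≥0∞)) :
    b = 0 := by
  by_contra hne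
  set κ : ℝ≥0∞ := ‖b‖ₑ ^ 2 * volume (ball (0 : EuclideanSpace ℝ (Fin 3)) 1) with hκ
  have hκ0 : κ ≠ 0 :=
    mul_ne_zero (pow_ne_zero _ (by simpa using hne)) (measure_ball_pos volume _ one_pos).ne'
  -- for every `a > 0`: `κ · a^{2ρ+2} ≤ c`
  have key : ∀ a : ℝ, 0 < a → κ * ENNReal.ofReal (a ^ (2 * ρ + 2)) ≤ (c : ℝ≥0∞) := by
    intro a ha
    have h1 := hA a ha
    have hslice : (ENNReal.ofReal a)⁻¹ * ∫⁻ x in ball (0 : EuclideanSpace ℝ (Fin 3)) a, ‖U x‖ₑ ^ 2 ≤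
        cknA a (0 : ℝ × EuclideanSpace ℝ (Fin 3)) (fun _ : ℝ => U) := by
      unfold cknA
      have hs : (-(a ^ 2) / 2 : ℝ) ∈ Ioo ((0 : ℝ × EuclideanSpace ℝ (Fin 3)).1 - a ^ 2)
          (0 : ℝ × EuclideanSpace ℝ (Fin 3)).1 := by
        have ha2 : 0 < a ^ 2 := by positivity
        simp only [Prod.fst_zero, zero_sub, mem_Ioo]
        constructor <;> linarith
      exact le_iSup₂ (f := fun t (_ : t ∈ Ioo ((0 : ℝ × EuclideanSpace ℝ (Fin 3)).1 - a ^ 2)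
          (0 : ℝ × EuclideanSpace ℝ (Fin 3)).1) =>
          (ENNReal.ofReal a)⁻¹ * ∫⁻ x in ball (0 : ℝ × EuclideanSpace ℝ (Fin 3)).2 a,
            ‖(fun _ : ℝ => U) t x‖ₑ ^ 2) (-(a ^ 2) / 2) hs
    have hint : ∫⁻ x in ball (0 : EuclideanSpace ℝ (Fin 3)) a, ‖U x‖ₑ ^ 2 =
        ‖b‖ₑ ^ 2 * (ENNReal.ofReal (a ^ 3) * volume (ball (0 : EuclideanSpace ℝ (Fin 3)) 1)) := by
      have h2 : ∫⁻ x in ball (0 : EuclideanSpace ℝ (Fin 3)) a, ‖U x‖ₑ ^ 2 =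
          ∫⁻ x in ball (0 : EuclideanSpace ℝ (Fin 3)) a, ‖b‖ₑ ^ 2 := by
        refine lintegral_congr_ae (ae_restrict_of_ae ?_)
        filter_upwards [hb] with x hx
        rw [hx]
      rw [h2, lintegral_const, Measure.restrict_apply_univ, Measure.addHaar_ball_of_pos _ _ ha,
        finrank_euclideanSpace_fin]
    have h3 : ENNReal.ofReal (a ^ (2 * ρ)) * ((ENNReal.ofReal a)⁻¹ *
        (‖b‖ₑ ^ 2 * (ENNReal.ofReal (a ^ 3) * volume (ball (0 : EuclideanSpace ℝ (Fin 3)) 1)))) ≤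
        (c : ℝ≥0∞) := by
      rw [← hint]
      exact le_trans (by gcongr) h1
    have h5 : ENNReal.ofReal (a ^ (2 * ρ)) * (ENNReal.ofReal a)⁻¹ * ENNReal.ofReal (a ^ 3) =
        ENNReal.ofReal (a ^ (2 * ρ + 2)) := by
      rw [← ENNReal.ofReal_inv_of_pos ha, ← ENNReal.ofReal_mul (by positivity),
        ← ENNReal.ofReal_mul (by positivity)]
      congr 1
      rw [show (2 * ρ + 2 : ℝ) = 2 * ρ + ((2 : ℕ) : ℝ) by norm_num, Real.rpow_add ha,
        Real.rpow_natCast]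
      field_simp
    have h4 : ENNReal.ofReal (a ^ (2 * ρ)) * ((ENNReal.ofReal a)⁻¹ *
        (‖b‖ₑ ^ 2 * (ENNReal.ofReal (a ^ 3) * volume (ball (0 : EuclideanSpace ℝ (Fin 3)) 1)))) =
        κ * ENNReal.ofReal (a ^ (2 * ρ + 2)) := by
      rw [hκ, ← h5]; ring
    rw [h4] at h3
    exact h3
  -- let `a → ∞`
  have hlim : Tendsto (fun a : ℝ => κ * ENNReal.ofReal (a ^ (2 * ρ + 2))) atTop (𝓝 ⊤) := by
    have h' := ENNReal.Tendsto.const_mul (a := κ)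
      (ENNReal.tendsto_ofReal_atTop.comp (tendsto_rpow_atTop (by linarith : 0 < 2 * ρ + 2)))
      (Or.inl ENNReal.top_ne_zero)
    rwa [ENNReal.mul_top hκ0] at h'
  obtain ⟨a, hca, ha⟩ :=
    ((hlim.eventually_const_lt (ENNReal.coe_lt_top (r := c))).and (eventually_gt_atTop 0)).exists
  exact lt_irrefl _ (hca.trans_le (key a ha))

/-! ## The rung -/

/-- **BC5 rung B of `EulerZoomLiouville.PowerGaugeEulerLiouville` — steady members vanish.**
For every `ρ > 0`, a STEADY ancient local-energy Euler flow `u(t, x) = U(x)` on `ℝ³ × (−∞, 0)`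
(suitable weak, `ν = 0`, `f = 0`, weak spatial gradient `H`) in Seregin's power-gauged class
`sup_{a>0} (a^{2ρ} A(a) + a^{ρ} E(a) + a^{2ρ} D(a)) ≤ c` at the origin is zero a.e. on the slab.
This is VERBATIM the planners' plan-only signature `PowerGaugeEulerLiouville_rung_steady_plan`
(`bc/PowerGaugeEulerLiouville_rungB_plan.lean` of the certified package `route-EulerZoomLiouville`),
inside the window `0 < ρ ≤ 1/2` where the full conjunct `E` is open (Seregin, arXiv:2606.29468 §4:
open question on ancient Euler solutions in the class (3.5)–(3.8); arXiv:2507.08733 Thm 1.1).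
Proof: `E`-gauge ⇒ zero spatial weak derivative (`hasWeakFDerivOn_zero_of_steady`) ⇒ a.e.
constant (`ae_eq_const_of_hasWeakFDerivOn_zero`) ⇒ zero by the `A`-gauge
(`const_eq_zero_of_gaugeA`).  The Euler system / local energy inequality (`_hsw`) is not used. -/
theorem powerGaugeEulerLiouville_steady :
    ∀ ρ : ℝ, 0 < ρ → ∀ (U : EuclideanSpace ℝ (Fin 3) → EuclideanSpace ℝ (Fin 3))
      (p : ℝ → EuclideanSpace ℝ (Fin 3) → ℝ)
      (H : ℝ → EuclideanSpace ℝ (Fin 3) → EuclideanSpace ℝ (Fin 3) →L[ℝ] EuclideanSpace ℝ (Fin 3))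
      (c : NNReal),
      Literature.Analysis.FluidPDE.IsSuitableWeakSolutionOn
          (Literature.Analysis.FluidPDE.slab (EuclideanSpace ℝ (Fin 3)) (Set.Iio 0) isOpen_Iio) 0 0
          (fun _ : ℝ => U) p →
      Literature.Analysis.FluidPDE.HasWeakSpatialGradientOn
          (Literature.Analysis.FluidPDE.slab (EuclideanSpace ℝ (Fin 3)) (Set.Iio 0) isOpen_Iio)
          (fun _ : ℝ => U) H →
      (∀ a : ℝ, 0 < a →
        ENNReal.ofReal (a ^ (2 * ρ)) *
            Literature.Analysis.FluidPDE.cknA a (0 : ℝ × EuclideanSpace ℝ (Fin 3)) (fun _ : ℝ => U) +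
          ENNReal.ofReal (a ^ ρ) *
            Literature.Analysis.FluidPDE.cknE a (0 : ℝ × EuclideanSpace ℝ (Fin 3)) H +
          ENNReal.ofReal (a ^ (2 * ρ)) *
            Literature.Analysis.FluidPDE.cknD a (0 : ℝ × EuclideanSpace ℝ (Fin 3)) p ≤
          (c : ENNReal)) →
      Function.uncurry (fun _ : ℝ => U) =ᵐ[volume.restrict
        (Set.Iio (0 : ℝ) ×ˢ (Set.univ : Set (EuclideanSpace ℝ (Fin 3))))] 0 := by
  intro ρ hρ U p H c _hsw hH hc
  have hE : ∀ a : ℝ, 0 < a →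
      ENNReal.ofReal (a ^ ρ) * cknE a (0 : ℝ × EuclideanSpace ℝ (Fin 3)) H ≤ (c : ℝ≥0∞) :=
    fun a ha => le_trans (le_trans le_add_self le_self_add) (hc a ha)
  have hA : ∀ a : ℝ, 0 < a → ENNReal.ofReal (a ^ (2 * ρ)) *
      cknA a (0 : ℝ × EuclideanSpace ℝ (Fin 3)) (fun _ : ℝ => U) ≤ (c : ℝ≥0∞) :=
    fun a ha => le_trans (le_trans le_self_add le_self_add) (hc a ha)
  have hHmeas : AEStronglyMeasurable (uncurry H)
      (volume.restrict (Iio (0 : ℝ) ×ˢ (univ : Set (EuclideanSpace ℝ (Fin 3))))) := by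
    have := hH.locallyIntegrableOn_grad.aestronglyMeasurable
    simpa [slab] using this
  have hsmall := small_of_gaugeE (by linarith) hHmeas hE
  have hW := hasWeakFDerivOn_zero_of_steady hH hsmall
  obtain ⟨b, hb⟩ := ae_eq_const_of_hasWeakFDerivOn_zero hW
  have hb0 : b = 0 := const_eq_zero_of_gaugeA (by linarith) hb hA
  subst hb0
  have h2 : (U ∘ Prod.snd : ℝ × EuclideanSpace ℝ (Fin 3) → EuclideanSpace ℝ (Fin 3)) =ᵐ[volume]
      ((fun _ => (0 : EuclideanSpace ℝ (Fin 3))) ∘ Prod.snd) := by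
    rw [Measure.volume_eq_prod]
    exact Measure.quasiMeasurePreserving_snd.ae_eq_comp hb
  exact ae_restrict_of_ae h2

/-- **Rung B is a literal sub-case of the crux** `E = EulerZoomLiouville.PowerGaugeEulerLiouville`
(stmt-NavierStokesRegularity-19832): specialising the route decl to time-independent fields
`u = fun _ => U` gives exactly the statement of `powerGaugeEulerLiouville_steady` (so the rung sits
strictly inside `E` and is never summit-strength). [folklore] -/
theorem steady_of_powerGaugeEulerLiouville
    (hE : Summit.NavierStokesRegularity.NavierStokesRegularity.Theses.EulerZoomLiouville.PowerGaugeEulerLiouville) :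
    ∀ ρ : ℝ, 0 < ρ → ∀ (U : EuclideanSpace ℝ (Fin 3) → EuclideanSpace ℝ (Fin 3))
      (p : ℝ → EuclideanSpace ℝ (Fin 3) → ℝ)
      (H : ℝ → EuclideanSpace ℝ (Fin 3) → EuclideanSpace ℝ (Fin 3) →L[ℝ] EuclideanSpace ℝ (Fin 3))
      (c : NNReal),
      Literature.Analysis.FluidPDE.IsSuitableWeakSolutionOn
          (Literature.Analysis.FluidPDE.slab (EuclideanSpace ℝ (Fin 3)) (Set.Iio 0) isOpen_Iio) 0 0
          (fun _ : ℝ => U) p →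
      Literature.Analysis.FluidPDE.HasWeakSpatialGradientOn
          (Literature.Analysis.FluidPDE.slab (EuclideanSpace ℝ (Fin 3)) (Set.Iio 0) isOpen_Iio)
          (fun _ : ℝ => U) H →
      (∀ a : ℝ, 0 < a →
        ENNReal.ofReal (a ^ (2 * ρ)) *
            Literature.Analysis.FluidPDE.cknA a (0 : ℝ × EuclideanSpace ℝ (Fin 3)) (fun _ : ℝ => U) +
          ENNReal.ofReal (a ^ ρ) *
            Literature.Analysis.FluidPDE.cknE a (0 : ℝ × EuclideanSpace ℝ (Fin 3)) H +
          ENNReal.ofReal (a ^ (2 * ρ)) *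
            Literature.Analysis.FluidPDE.cknD a (0 : ℝ × EuclideanSpace ℝ (Fin 3)) p ≤
          (c : ENNReal)) →
      Function.uncurry (fun _ : ℝ => U) =ᵐ[volume.restrict
        (Set.Iio (0 : ℝ) ×ˢ (Set.univ : Set (EuclideanSpace ℝ (Fin 3))))] 0 :=
  fun ρ hρ U p H c hsw hH hc => hE ρ hρ (fun _ : ℝ => U) p H c hsw hH hc

end Steady

end Summit.NavierStokesRegularity.NavierStokesRegularity.Theorems.PowerGaugeEulerLiouville
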